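import Mathlib.Algebra.Order.Field.Basic
import Mathlib.Algebra.Order.BigOperators.Group.Finset
import Mathlib.Tactic.Ring
import Mathlib.Tactic.Linarith
import Mathlib.Tactic.Positivity
import Mathlib.Tactic.FieldSimp
import Summits.Ventures.CertifiedArithmetic.LowPrec.SRAccumulation
import HarnessLib

/-!
# Stochastic rounding into a finite format, III: envelopes — `√n` law, pair tables, sure bound

HONEST FRAMING: certified error envelopes and provably optimal rounding/accumulation schemes for
low-precision formats under stated cost models; every table by two implementations; no hardware or
vendor claims.

File 3 of 3.
* `accVar_le` — `accVar ≤ n G²/4` whenever every pre-rounding value on every branch has candidate gap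
  `≤ G` (`G = 2u·M` in a normal range of modulus `≤ M`, `G =` the subnormal quantum below the smallest
  normal: the hypothesis that replaces "no underflow");
* `accVar_le_of_mem`, `gapLE_of_mem`, `prob_dev_ge_le_of_mem` — for format-valued inputs every
  pre-rounding value is a sum of two format values, so the path hypotheses reduce to an exhaustive
  PAIR TABLE over `F × F` (kernel-`decide`d for FP4/FP6, two-implementation enumerated for FP8);
* `prob_dev_ge_le_accVar`, `prob_dev_ge_le` — Bienaymé–Chebyshev: `P(|ŝₙ − ∑| ≥ t) ≤ accVar/t²
  ≤ n G²/(4t²)`, i.e. error `< (G/2)√(n/λ)` with probability `> 1 − λ` (√n growth);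
* `allOutcomes_abs_sub_le` — the sure bound `|ŝₙ − ∑| ≤ n·G` (linear growth) for contrast.

References: [ConnollyHighamMary2021] §4; [ArarEtAl2023] §3–4 (variance + Bienaymé–Chebyshev method).
-/

namespace Summit.Ventures.CertifiedArithmetic.LowPrec.SR

open Literature.ComputerArithmetic.ConnollyHighamMary2021
open Finset

variable {K : Type*} [Field K] [LinearOrder K] [IsStrictOrderedRing K]

/-! ### Growth of the variance: `≤ n G² / 4` -/

/-- The accumulated variance is nonnegative. -/
theorem accVar_nonneg (F : Finset K) (x : ℕ → K) (n : ℕ) (s : K) : 0 ≤ accVar F x n s := by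
  induction n generalizing x s with
  | zero => exact le_rfl
  | succ n ih =>
      simp only [accVar]
      refine add_nonneg (srVar_nonneg F _) ?_
      have := step_mono F (s + x 0) (f := fun _ => (0 : K)) (g := accVar F (fun i => x (i + 1)) n)
        (fun t => ih _ t)
      rwa [step_const] at this

/-- A one-step expectation is bounded by any common bound at the two candidates. -/
theorem step_le_of (F : Finset K) (c : K) {f : K → K} {a : K} (hu : f (up F c) ≤ a)
    (hd : f (dn F c) ≤ a) : step F c f ≤ a := by
  unfold step
  have hp := pUp_nonneg F c
  have hq : 0 ≤ 1 - pUp F c := sub_nonneg.mpr (pUp_le_one F c)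
  nlinarith [mul_le_mul_of_nonneg_left hu hp, mul_le_mul_of_nonneg_left hd hq]

/-- **Variance growth.** If every pre-rounding value on every branch has candidate gap `≤ G`, then
`accVar ≤ n G²/4` (so the standard deviation grows like `√n · G/2`). -/
theorem accVar_le (F : Finset K) (G : K) (x : ℕ → K) (n : ℕ) (s : K) (h : GapLE F G x n s) :
    accVar F x n s ≤ n * G ^ 2 / 4 := by
  induction n generalizing x s with
  | zero => simp [accVar]
  | succ n ih =>
      obtain ⟨hg, hu, hd⟩ := h
      simp only [accVar]
      have h1 : srVar F (clamp F (s + x 0)) ≤ G ^ 2 / 4 := by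
        refine (srVar_le_gap_sq_div_four F _).trans ?_
        have h0 : 0 ≤ roundUp F (clamp F (s + x 0)) - roundDown F (clamp F (s + x 0)) :=
          sub_nonneg.mpr (roundDown_le_roundUp F _)
        have := mul_self_le_mul_self h0 hg
        nlinarith [this]
      have h2 : step F (s + x 0) (accVar F (fun i => x (i + 1)) n) ≤ n * G ^ 2 / 4 :=
        step_le_of F _ (ih _ _ hu) (ih _ _ hd)
      push_cast
      linarith

/-! ### Envelopes from a PAIR table

When the inputs are themselves format values (`x k ∈ F`, start `s ∈ F`), every pre-rounding value is
a sum of two format values, so path-wise hypotheses reduce to finitely many checks over `F × F` —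
an exhaustive pair table (kernel-`decide`d for FP4/FP6, two-implementation enumerated for FP8). -/

omit [IsStrictOrderedRing K] in
/-- Path-wise gap bound from a PAIR table, for format-valued inputs and start. -/
theorem gapLE_of_mem {F : Finset K} (hF : F.Nonempty) (G : K)
    (hG : ∀ a ∈ F, ∀ b ∈ F, roundUp F (clamp F (a + b)) - roundDown F (clamp F (a + b)) ≤ G)
    (x : ℕ → K) (n : ℕ) (s : K) (hs : s ∈ F) (hx : ∀ i, x i ∈ F) : GapLE F G x n s := by
  induction n generalizing x s with
  | zero => trivial
  | succ n ih =>
      exact ⟨hG s hs (x 0) (hx 0), ih _ _ (up_mem hF _) (fun i => hx (i + 1)),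
        ih _ _ (dn_mem hF _) (fun i => hx (i + 1))⟩

/-- **n-term variance envelope from the pair table**: if `v_F(clamp(a + b)) ≤ V` for all format values
`a, b`, then `accVar ≤ n·V` for every input stream of format values (no saturation hypothesis). -/
theorem accVar_le_of_mem {F : Finset K} (hF : F.Nonempty) (V : K)
    (hV : ∀ a ∈ F, ∀ b ∈ F, srVar F (clamp F (a + b)) ≤ V)
    (x : ℕ → K) (n : ℕ) (s : K) (hs : s ∈ F) (hx : ∀ i, x i ∈ F) : accVar F x n s ≤ n * V := by
  induction n generalizing x s with
  | zero => simp [accVar]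
  | succ n ih =>
      simp only [accVar]
      have h1 := hV s hs (x 0) (hx 0)
      have h2 : step F (s + x 0) (accVar F (fun i => x (i + 1)) n) ≤ n * V :=
        step_le_of F _ (ih _ _ (up_mem hF _) (fun i => hx (i + 1)))
          (ih _ _ (dn_mem hF _) (fun i => hx (i + 1)))
      push_cast
      linarith

/-! ### Envelopes from the format's MAXIMAL SPACING (a `|F|`-sized check, any inputs)

If every non-maximal format value has a successor within distance `G ≥ 0` (the maximal spacing of `F`,
e.g. the top-binade ulp), then EVERY clamped pre-rounding value has candidate gap `≤ G`, for arbitrary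
(not necessarily representable) inputs: `GapLE G` holds universally and `accVar ≤ n G²/4`. -/

/-- Candidate gap bound on the hull from the successor property of `F`. -/
theorem gap_le_of_succ {F : Finset K} (hF : F.Nonempty) {G : K} (hG : 0 ≤ G)
    (hsucc : ∀ a ∈ F, a < F.max' hF → ∃ b ∈ F, a < b ∧ b ≤ a + G) {x : K} (hx : InHull F x) :
    roundUp F x - roundDown F x ≤ G := by
  have hd : roundDown F x ∈ F := roundDown_mem hx.1
  by_cases hxm : roundDown F x < F.max' hF
  · obtain ⟨b, hb, hab, hbG⟩ := hsucc _ hd hxm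
    have hxb : x ≤ b := by
      by_contra hlt
      exact absurd (le_roundDown_of_mem hb (le_of_lt (lt_of_not_ge hlt))) (not_le.mpr hab)
    have hub : roundUp F x ≤ b := roundUp_le_of_mem hb hxb
    linarith
  · have hmax : roundDown F x = F.max' hF := le_antisymm (F.le_max' _ hd) (not_lt.mp hxm)
    obtain ⟨z, hz, hxz⟩ := hx.2
    have hxle : x ≤ F.max' hF := hxz.trans (F.le_max' z hz)
    have hxeq : x = F.max' hF := le_antisymm hxle (hmax ▸ roundDown_le F x)
    have hxF : x ∈ F := hxeq ▸ F.max'_mem hF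
    rw [roundUp_eq_self_of_mem hxF, roundDown_eq_self_of_mem hxF, sub_self]
    exact hG

/-- `GapLE G` holds for ALL inputs and starts once `G ≥ 0` bounds the spacing of `F`. -/
theorem gapLE_of_succ {F : Finset K} (hF : F.Nonempty) {G : K} (hG : 0 ≤ G)
    (hsucc : ∀ a ∈ F, a < F.max' hF → ∃ b ∈ F, a < b ∧ b ≤ a + G)
    (x : ℕ → K) (n : ℕ) (s : K) : GapLE F G x n s := by
  induction n generalizing x s with
  | zero => trivial
  | succ n ih => exact ⟨gap_le_of_succ hF hG hsucc (clamp_inHull hF _), ih _ _, ih _ _⟩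

/-- **n-term variance envelope from the maximal spacing**: `accVar ≤ n G²/4` for every input stream
and start, on any format whose spacing is `≤ G`. -/
theorem accVar_le_of_succ {F : Finset K} (hF : F.Nonempty) {G : K} (hG : 0 ≤ G)
    (hsucc : ∀ a ∈ F, a < F.max' hF → ∃ b ∈ F, a < b ∧ b ≤ a + G)
    (x : ℕ → K) (n : ℕ) (s : K) : accVar F x n s ≤ n * G ^ 2 / 4 :=
  accVar_le F G x n s (gapLE_of_succ hF hG hsucc x n s)

/-! ### Chebyshev: the `√n` probabilistic bound, and the sure linear bound -/

/-- Indicator of the deviation event `{t ≤ |v − a|}` (its `accExp` is the event's probability). -/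
def devInd (t a : K) (v : K) : K := if t ≤ |v - a| then 1 else 0

/-- Markov/Chebyshev pointwise inequality `𝟙{t ≤ |v−a|} ≤ (v−a)²/t²`. -/
theorem devInd_le_sq_div (t a v : K) (ht : 0 < t) : devInd t a v ≤ (v - a) ^ 2 / t ^ 2 := by
  unfold devInd
  split_ifs with h
  · rw [le_div_iff₀ (pow_pos ht 2), one_mul]
    have h0 : 0 ≤ t := ht.le
    calc t ^ 2 ≤ |v - a| ^ 2 := by gcongr
      _ = (v - a) ^ 2 := sq_abs _
  · positivity

/-- **Bienaymé–Chebyshev for SR recursive summation (exact-variance form).** Without saturation,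
`P(|ŝₙ − (s + ∑ xₖ)| ≥ t) ≤ accVar / t²`. -/
theorem prob_dev_ge_le_accVar (F : Finset K) (x : ℕ → K) (n : ℕ) (s : K) (h : NoSat F x n s)
    {t : K} (ht : 0 < t) :
    accExp F x n (devInd t (s + ∑ i ∈ range n, x i)) s ≤ accVar F x n s / t ^ 2 := by
  calc accExp F x n (devInd t (s + ∑ i ∈ range n, x i)) s
      ≤ accExp F x n (fun v => (t ^ 2)⁻¹ * (v - (s + ∑ i ∈ range n, x i)) ^ 2) s :=
        accExp_mono F x n (fun v => by
          rw [← div_eq_inv_mul]; exact devInd_le_sq_div t _ v ht) s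
    _ = accVar F x n s / t ^ 2 := by
        rw [accExp_mul_left, accExp_sq_sub_sum F x n s h, div_eq_inv_mul]

/-- **The `√n` bound.** If no branch saturates and every pre-rounding value has candidate gap `≤ G`
(e.g. `G = 2u·M` when all partial sums stay normal with modulus `≤ M`, or `G =` the subnormal
spacing when they stay below the smallest normal), then for every `t > 0`,
`P(|ŝₙ − (s + ∑ xₖ)| ≥ t) ≤ n G² / (4 t²)`; equivalently `|ŝₙ − ∑| < (G/2)·√(n/λ)` with
probability `> 1 − λ`. -/
theorem prob_dev_ge_le (F : Finset K) (G : K) (x : ℕ → K) (n : ℕ) (s : K) (h : NoSat F x n s)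
    (hG : GapLE F G x n s) {t : K} (ht : 0 < t) :
    accExp F x n (devInd t (s + ∑ i ∈ range n, x i)) s ≤ n * G ^ 2 / (4 * t ^ 2) := by
  refine (prob_dev_ge_le_accVar F x n s h ht).trans ?_
  rw [div_le_div_iff₀ (pow_pos ht 2) (by positivity)]
  have := accVar_le F G x n s hG
  have ht2 : 0 < t ^ 2 := pow_pos ht 2
  nlinarith

/-- **Chebyshev from the pair table**: `P(|ŝₙ − (s + ∑ xₖ)| ≥ t) ≤ n·V / t²` for format-valued
inputs without a saturating branch. -/
theorem prob_dev_ge_le_of_mem {F : Finset K} (hF : F.Nonempty) (V : K)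
    (hV : ∀ a ∈ F, ∀ b ∈ F, srVar F (clamp F (a + b)) ≤ V)
    (x : ℕ → K) (n : ℕ) (s : K) (hs : s ∈ F) (hx : ∀ i, x i ∈ F) (h : NoSat F x n s)
    {t : K} (ht : 0 < t) :
    accExp F x n (devInd t (s + ∑ i ∈ range n, x i)) s ≤ n * V / t ^ 2 := by
  refine (prob_dev_ge_le_accVar F x n s h ht).trans ?_
  exact div_le_div_of_nonneg_right (accVar_le_of_mem hF V hV x n s hs hx) (pow_pos ht 2).le

/-- **Chebyshev from the maximal spacing**: without a saturating branch,
`P(|ŝₙ − (s + ∑ xₖ)| ≥ t) ≤ n G²/(4t²)` for every input stream. -/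
theorem prob_dev_ge_le_of_succ {F : Finset K} (hF : F.Nonempty) {G : K} (hG : 0 ≤ G)
    (hsucc : ∀ a ∈ F, a < F.max' hF → ∃ b ∈ F, a < b ∧ b ≤ a + G)
    (x : ℕ → K) (n : ℕ) (s : K) (h : NoSat F x n s) {t : K} (ht : 0 < t) :
    accExp F x n (devInd t (s + ∑ i ∈ range n, x i)) s ≤ n * G ^ 2 / (4 * t ^ 2) :=
  prob_dev_ge_le F G x n s h (gapLE_of_succ hF hG hsucc x n s) ht

omit [IsStrictOrderedRing K] in
/-- `AllOutcomes` is monotone in the predicate. -/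
theorem allOutcomes_mono (F : Finset K) (x : ℕ → K) (n : ℕ) {P Q : K → Prop} (hPQ : ∀ v, P v → Q v)
    (s : K) (h : AllOutcomes F x n P s) : AllOutcomes F x n Q s := by
  induction n generalizing x s with
  | zero => exact hPQ s h
  | succ n ih => exact ⟨ih _ _ h.1, ih _ _ h.2⟩

/-- **The sure (worst-case) bound is linear**: on every branch `|ŝₙ − (s + ∑ xₖ)| ≤ n·G`. -/
theorem allOutcomes_abs_sub_le (F : Finset K) (G : K) (x : ℕ → K) (n : ℕ) (s : K)
    (h : NoSat F x n s) (hG : GapLE F G x n s) :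
    AllOutcomes F x n (fun v => |v - (s + ∑ i ∈ range n, x i)| ≤ n * G) s := by
  induction n generalizing x s with
  | zero => simp [AllOutcomes]
  | succ n ih =>
      obtain ⟨hc, hu, hd⟩ := h
      obtain ⟨hg, hgu, hgd⟩ := hG
      have hcl := clamp_eq_self hc
      have gap_nn : 0 ≤ G := le_trans (sub_nonneg.mpr (roundDown_le_roundUp F _)) hg
      have eu : |up F (s + x 0) - (s + x 0)| ≤ G := by
        have := abs_roundUp_sub_le F (clamp F (s + x 0))
        unfold up; rw [hcl] at this ⊢; exact this.trans (hcl ▸ hg)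
      have ed : |dn F (s + x 0) - (s + x 0)| ≤ G := by
        have := abs_roundDown_sub_le F (clamp F (s + x 0))
        unfold dn; rw [hcl] at this ⊢; exact this.trans (hcl ▸ hg)
      simp only [AllOutcomes]
      constructor
      · refine allOutcomes_mono F _ n (fun v hv => ?_) _ (ih _ _ hu hgu)
        rw [sum_range_succ']
        calc |v - (s + (∑ i ∈ range n, x (i + 1) + x 0))|
            = |(v - (up F (s + x 0) + ∑ i ∈ range n, x (i + 1))) + (up F (s + x 0) - (s + x 0))| := by
              ring_nf
          _ ≤ |v - (up F (s + x 0) + ∑ i ∈ range n, x (i + 1))| + |up F (s + x 0) - (s + x 0)| :=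
              abs_add_le _ _
          _ ≤ n * G + G := add_le_add hv eu
          _ = (↑(n + 1) : K) * G := by push_cast; ring
      · refine allOutcomes_mono F _ n (fun v hv => ?_) _ (ih _ _ hd hgd)
        rw [sum_range_succ']
        calc |v - (s + (∑ i ∈ range n, x (i + 1) + x 0))|
            = |(v - (dn F (s + x 0) + ∑ i ∈ range n, x (i + 1))) + (dn F (s + x 0) - (s + x 0))| := by
              ring_nf
          _ ≤ |v - (dn F (s + x 0) + ∑ i ∈ range n, x (i + 1))| + |dn F (s + x 0) - (s + x 0)| :=
              abs_add_le _ _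
          _ ≤ n * G + G := add_le_add hv ed
          _ = (↑(n + 1) : K) * G := by push_cast; ring

end Summit.Ventures.CertifiedArithmetic.LowPrec.SR
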